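/-
Copyright (c) 2026 the pub-hodgecm-mathlib formalisation cell (harness21).  Prover seat hodgecm-mathlib-K2Liu-p03 (g8), Track B «K2-LIT»,
#184♮ = hLiu418 = `stmt-HodgeConjecture-24832`; socket #41, KIND 1 — (K1a-T)(C-d) THE (L4) COUNT LETTER IN THE `D`-CURRENCY: `(16∕3)^{#Pm S h} ≤ Cp·‖h‖^{ap}·(1+τa S)^{Np}·D^{Nd}`
for the witnesses of ★ p864217 (A) `htail_hsplit_witnesses_of_record` (K1-a♮ line lead K2E5-p16 (g8) WORD #12 (1)(2) 2026-09-05T01:20:29Z: the currency of record; LEAD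
F0P6-plan BATCH #227 «p03's W + C road owns the count»).  THEOREMS ONLY (no `def`, no `instance`, no notation, no named-fact hypothesis, no `sorry`).
-/
import Summits.HodgeConjecture.HodgeConjecture.Theorems.K2LiuKindOneSingularTailWitnesses      -- ★ p864217 (A) ED. 2 (this seat): the witnesses' defining letters (f)(g)(h1)(h2)(h3)
import Summits.HodgeConjecture.HodgeConjecture.Theorems.K2LiuKindWPlacesCount                  -- ★ p864221 (C-c) (LH7-p05): `two_pow_card_kindWFinset_sdiff_le`
import Summits.HodgeConjecture.HodgeConjecture.Theorems.K2LiuCornerScalarPoleCount           -- ★ p864275 (C-d-i) (LH7-p05): `exists_cornerScalar_den_pole_count`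
import Summits.HodgeConjecture.HodgeConjecture.Theorems.K2LiuKindOneLineTranslateHeight         -- ★ `adelicHeightGL_leviRow_translate_le`
import Summits.HodgeConjecture.HodgeConjecture.Theorems.K2LiuRowSectionHeightLeVecHeight        -- ★ (B-ii) `exists_adelicHeightGL_rowSection_le`
import Summits.HodgeConjecture.HodgeConjecture.Theorems.K2LiuVecHeightVsMulHeight              -- ★ p863361 (B-i) `exists_vecHeight_principalVec_le_mulHeight_pow`
import Summits.HodgeConjecture.HodgeConjecture.Theorems.K2LiuLeviHomHeightBound                -- ★ (B-iii) `exists_adelicHeightGL_leviHom_le_sq`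
import Summits.HodgeConjecture.HodgeConjecture.Theorems.K2LiuClosedSubgroupHeightBallVolume     -- ★ `finprod_localHeight_le_mul_adelicHeightGL` (`∏_w H_w ≤ N‖·‖`)
import HarnessLib

/-!
# Crux `HLiu418`, socket #41, KIND 1 a♮ — (K1a-T)(C-d) `K2LiuKindOneSingularShellCount`: THE MOVING PLACE SET OF THE SINGULAR TAIL IS COUNTED IN THE `D`-CURRENCY

Cell `hodgecm-mathlib`, crux item hLiu418 = `stmt-HodgeConjecture-24832` (helper lane `--supports … --as helper`, count-neutral), route of record `HCCMUnconditional`;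
squad K2 ∕ K2Liu, road `K2_Liu`, socket #41, KIND 1, block K1-a♮.  CONSUMER: K2E4-p10 (g10)'s `hGb_of_countLetter_den` ∕ `hdec_of_factorBounds_den` (the (L4) slot of
★ p864035 ∕ ★ p863488 in the `D`-currency of desk WORD #12), fed at the tie from ★ p864217's `obtain`.

THE LETTER.  With the witnesses of ★ (A) `htail_hsplit_witnesses_of_record` — `Pm S h = T S h ∖ T₀`, `T S h = kindWFinset (T₀ ∪ Tp S) (σc(S)E₁₁) (gc S·h)`,
`Tp S = T_rec ∪ Pol(τ(σc S))`, `gc S = Λ(γ[w S])`, `↑S = u S ⊗ w S`, `T_L k k·S k k = c(γ[w S]₁ₖ)·t₁·σc S·γ[w S]₁ₖ` — taken BY VALUE (so the tie passes ★ (A)'s names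
positionally), a NORMALISED row section `γ` (★ `exists_normalised_rowSection`'s entry letter `hnorm`) and the Levi chart's block law `hΛ`:
`∃ Np Nd Cp ap, 0 ≤ Cp ∧ 0 ≤ ap ∧ ∀ S h, rank-one → ∀ D ≥ 1, D·S ℤ-integral → (16∕3)^{#Pm S h} ≤ Cp · ‖h‖^{ap} · (1 + τa S)^{Np} · D^{Nd}`.
Proof: `#Pm ≤ #(K ∖ (T₀ ∪ Tp S)) + #T_rec + #Pol`; the first by ★ (C-c) `two_pow_card_kindWFinset_sdiff_le` at `S' := σc(S)E₁₁` (`S'⁻¹ = 0`), denominator `D·d₀`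
(★ (C-d-i) `exists_cornerScalar_den_pole_count`, LH7-p05 (g3): `σc S = (t_i∕t₁)·S_ii` at the pivot `i` of the normalised section), with `∏_w H_w(gc S·h) ≤ 4‖gc S·h‖` (★ `finprod_localHeight_le_mul_adelicHeightGL`) and
`‖Λ(γ[w S])·h‖ ≤ 4C₀·(D(1+τa S))^{k}·‖h‖` (★ `adelicHeightGL_leviRow_translate_le`, the clause `‖Λ(γ[w])‖ ≤ C₀H(w)^{k₀}` re-derived for the GIVEN `γ` from ★ (B-i)(B-ii)(B-iii)
exactly as ★ (ρ6a)); the third by ★ (C-d-i)'s pole count `(16∕3)^{#Pol} ≤ (D d₀)^{3[L⁺:ℚ]}`; `T_rec` is a constant.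
* `inv_single_eq_zero` — `(σ E₁₁)⁻¹ = 0` in `M₂(L)`;
* **`pow_card_Pm_le_den`** — the letter.
HONEST LABEL.  Count-neutral helper; it closes no socket: `HC_CM` is proved only modulo the 7 printed citations (2 remaining named inputs: hLiu418 =
`stmt-HodgeConjecture-24832`, h413 = `stmt-HodgeConjecture-24833`) until rung 0 closes.

## References
* [KudlaRallis1994] S. Kudla, S. Rallis, *A regularized Siegel–Weil formula: the first term identity*, Ann. of Math. 140 (1994): §2 (2.10)–(2.12).
* [BorelJacquet1979] A. Borel, H. Jacquet, *Automorphic forms and automorphic representations*, PSPM 33.1 (1979): §1.2.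
* [MoeglinWaldspurger1995] C. Mœglin, J.-L. Waldspurger, *Spectral Decomposition and Eisenstein Series* (1995): I.2.2, II.1.7.
* [BombieriGubler2006] E. Bombieri, W. Gubler, *Heights in Diophantine Geometry* (2006): §1.5.
* [NeukirchANT1999] J. Neukirch, *Algebraic Number Theory* (1999): Ch. I §6 Prop. (6.1).
-/

set_option autoImplicit false
-- the mandated namespace repeats the single-problem summit's segment (`HodgeConjecture.HodgeConjecture`)
set_option linter.dupNamespace false

noncomputable section

open scoped Matrix NNReal MatrixGroups
open NumberField IsDedekindDomain

namespace Summit.HodgeConjecture.HodgeConjecture.Cruxes.HLiu418.K2LiuKindOneSingularShellCount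

open Literature.NumberTheory.Automorphic Literature.NumberTheory.Automorphic.UnitaryGroup Literature.NumberTheory.GaloisRepresentations
open Literature.NumberTheory.GelbartRogawski1991 Literature.NumberTheory.GelbartRogawski1991.GRConstruction
open Literature.NumberTheory.GelbartRogawski1991.AdaptedBlocks
open Literature.NumberTheory.GelbartRogawski1991.UnitaryDualPair
open Literature.NumberTheory.K2Lit.SiegelDoubled
open Summit.HodgeConjecture.HodgeConjecture.Cruxes.HLiu418.K2LiuSiegelUnipotentLocalDefs
open Summit.HodgeConjecture.HodgeConjecture.Cruxes.HLiu418.K2LiuSiegelUnipotentSplitDefs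
open Summit.HodgeConjecture.HodgeConjecture.Cruxes.HLiu418.K2LiuSiegelUnipotentSplitAtDefs
open Summit.HodgeConjecture.HodgeConjecture.Cruxes.HLiu418.K2LiuSiegelUnipotentFourierDefs
open Summit.HodgeConjecture.HodgeConjecture.Cruxes.HLiu418.K2LiuSiegelEisensteinKindWLetters
open Summit.HodgeConjecture.HodgeConjecture.Cruxes.HLiu418.K2LiuSiegelMiddleCellLeviCriterion (row_ne_zero)
open Summit.HodgeConjecture.HodgeConjecture.Cruxes.HLiu418.K2LiuKindWPlacesCount (two_pow_card_kindWFinset_sdiff_le)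
open Summit.HodgeConjecture.HodgeConjecture.Cruxes.HLiu418.K2LiuCornerScalarPoleCount (exists_cornerScalar_den_pole_count)
open Summit.HodgeConjecture.HodgeConjecture.Cruxes.HLiu418.K2LiuKindOneLineTranslateHeight (adelicHeightGL_leviRow_translate_le)
open Summit.HodgeConjecture.HodgeConjecture.Cruxes.HLiu418.K2LiuRowSectionHeightLeVecHeight (exists_adelicHeightGL_rowSection_le)
open Summit.HodgeConjecture.HodgeConjecture.Cruxes.HLiu418.K2LiuVecHeightVsMulHeight (exists_vecHeight_principalVec_le_mulHeight_pow)
open Summit.HodgeConjecture.HodgeConjecture.Cruxes.HLiu418.K2LiuLeviHomHeightBound (exists_adelicHeightGL_leviHom_le_sq)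
open Summit.HodgeConjecture.HodgeConjecture.Cruxes.HLiu418.K2LiuClosedSubgroupHeightBallVolume (finprod_localHeight_le_mul_adelicHeightGL)

variable (L : Type) [Field L] [NumberField L] [IsCMField L]

omit [NumberField L] [IsCMField L] in
/-- the corner index `σ E₁₁ ∈ M₂(L)` is singular, so its (`Matrix.inv`) inverse is `0`. [folklore] -/
theorem inv_single_eq_zero (σ : L) : (Matrix.single (1 : Fin 2) (1 : Fin 2) σ)⁻¹ = 0 := by
  apply Matrix.nonsing_inv_apply_not_isUnit
  rw [Matrix.det_fin_two]
  simp

section Count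

variable {N M : ℕ} (e : Fin N × Fin M ≃ Fin 2)
  (dV : Fin N → L) (hdV : ∀ i, IsCMField.complexConj L (dV i) = dV i)
  (dW : Fin M → L) (hdW : ∀ i, IsCMField.complexConj L (dW i) = dW i)
  [DecidableEq (HeightOneSpectrum (𝓞 (Fp L)))]

open Classical in -- the archimedean size `‖(ι_∞ S_ab)_ab‖` is read with the consumers' instances (★ p863404 ∕ ★ p864122: `open Classical in`)
/-- **(K1a-T)(C-d) THE (L4) COUNT LETTER IN THE `D`-CURRENCY.**  DATA (all by value, the tie passes ★ names positionally): `dV dW ≠ 0`; the Levi chart `Λ` with ★ α3-2's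
block law `hΛ`; a NORMALISED row section `γ` (`hnorm` = ★ `exists_normalised_rowSection`'s entry letter); the bad set `T₀`; ★ (A) `htail_hsplit_witnesses_of_record`'s witnesses `σc gc T Pm u w hw Trec Tp` with its defining
letters (f) `hgc`, (g) `hpres`, (h1) `hTeq`, (h2) `hTp`, (h3) `hPm`; the archimedean size `τa` (`hτa`).  THEN
`∃ Np Nd Cp ap, 0 ≤ Cp ∧ 0 ≤ ap ∧ ∀ S h, ↑S ≠ 0 → det ↑S = 0 → ∀ D ≥ 1, (∀ a b, IsIntegral ℤ (D·S a b)) → (16∕3)^{#Pm S h} ≤ Cp·‖h‖^{ap}·(1 + τa S)^{Np}·D^{Nd}`.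
[cite: KudlaRallis1994, §2 (2.10)–(2.12)] [cite: BorelJacquet1979, §1.2] [cite: MoeglinWaldspurger1995, I.2.2, II.1.7] [cite: BombieriGubler2006, §1.5] [cite: NeukirchANT1999, Ch. I §6 Prop. (6.1)] -/
theorem pow_card_Pm_le_den (hdV0 : ∀ i, dV i ≠ 0) (hdW0 : ∀ i, dW i ≠ 0)
    -- the Levi chart with its block law and a NORMALISED row section
    (Λ : GL (Fin 2) (AdeleRing (𝓞 L) L) →* HA L e dV hdV dW hdW)
    (hΛ : ∀ g : GL (Fin 2) (AdeleRing (𝓞 L) L), blk L e dV hdV dW hdW (Λ g) =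
      cayR (AdeleRing (𝓞 L) L) (Fin 2) * Matrix.fromBlocks (g : Matrix (Fin 2) (Fin 2) (AdeleRing (𝓞 L) L)) 0 0
        (((gramR L e dV hdV dW hdW).map ((algebraMap L (AdeleRing (𝓞 L) L)).comp (algebraMap (Fp L) L)))⁻¹ *
          (((g⁻¹ : GL (Fin 2) (AdeleRing (𝓞 L) L)) : Matrix (Fin 2) (Fin 2) (AdeleRing (𝓞 L) L)).map
            (conjAdele (Fp L) L (IsCMField.complexConj L)))ᵀ *
          (gramR L e dV hdV dW hdW).map ((algebraMap L (AdeleRing (𝓞 L) L)).comp (algebraMap (Fp L) L))) *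
        cayRinv (AdeleRing (𝓞 L) L) (Fin 2))
    (γ : Projectivization L (Fin 2 → L) → GL (Fin 2) L)
    (hnorm : ∀ (w : Fin 2 → L) (hw : w ≠ 0), ∃ i : Fin 2, w i ≠ 0 ∧
      (γ (Projectivization.mk L w hw) : Matrix (Fin 2) (Fin 2) L) 1 = (w i)⁻¹ • w ∧
      ∀ a b : Fin 2,
        (∃ k : Fin 2, (γ (Projectivization.mk L w hw) : Matrix (Fin 2) (Fin 2) L) a b = 0 ∨
          (γ (Projectivization.mk L w hw) : Matrix (Fin 2) (Fin 2) L) a b = 1 ∨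
          (γ (Projectivization.mk L w hw) : Matrix (Fin 2) (Fin 2) L) a b = (w i)⁻¹ * w k ∨
          (γ (Projectivization.mk L w hw) : Matrix (Fin 2) (Fin 2) L) a b = -((w i)⁻¹ * w k)) ∧
        (∃ k : Fin 2, (((γ (Projectivization.mk L w hw))⁻¹ : GL (Fin 2) L) : Matrix (Fin 2) (Fin 2) L) a b = 0 ∨
          (((γ (Projectivization.mk L w hw))⁻¹ : GL (Fin 2) L) : Matrix (Fin 2) (Fin 2) L) a b = 1 ∨
          (((γ (Projectivization.mk L w hw))⁻¹ : GL (Fin 2) L) : Matrix (Fin 2) (Fin 2) L) a b = (w i)⁻¹ * w k ∨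
          (((γ (Projectivization.mk L w hw))⁻¹ : GL (Fin 2) L) : Matrix (Fin 2) (Fin 2) L) a b = -((w i)⁻¹ * w k)))
    -- the bad set and ★ (A)'s witnesses with their defining letters (f)(g)(h1)(h2)(h3), BY VALUE
    (T₀ : Finset (HeightOneSpectrum (𝓞 (Fp L))))
    (σc : skewMatrices ((IsCMField.complexConj L : L ≃ₐ[Fp L] L) : L →+* L) ((gramR L e dV hdV dW hdW).map (algebraMap (Fp L) L)) → L)
    (gc : skewMatrices ((IsCMField.complexConj L : L ≃ₐ[Fp L] L) : L →+* L) ((gramR L e dV hdV dW hdW).map (algebraMap (Fp L) L)) → HA L e dV hdV dW hdW)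
    (T Pm : skewMatrices ((IsCMField.complexConj L : L ≃ₐ[Fp L] L) : L →+* L) ((gramR L e dV hdV dW hdW).map (algebraMap (Fp L) L)) → HA L e dV hdV dW hdW →
      Finset (HeightOneSpectrum (𝓞 (Fp L))))
    (u w : skewMatrices ((IsCMField.complexConj L : L ≃ₐ[Fp L] L) : L →+* L) ((gramR L e dV hdV dW hdW).map (algebraMap (Fp L) L)) → Fin 2 → L)
    (hw : ∀ S, w S ≠ 0) (Trec : Finset (HeightOneSpectrum (𝓞 (Fp L))))
    (Tp : skewMatrices ((IsCMField.complexConj L : L ≃ₐ[Fp L] L) : L →+* L) ((gramR L e dV hdV dW hdW).map (algebraMap (Fp L) L)) → Finset (HeightOneSpectrum (𝓞 (Fp L))))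
    (hgc : ∀ S, gc S = Λ (Matrix.GeneralLinearGroup.map (algebraMap L (AdeleRing (𝓞 L) L)) (γ (Projectivization.mk L (w S) (hw S)))))
    (hpres : ∀ S : skewMatrices ((IsCMField.complexConj L : L ≃ₐ[Fp L] L) : L →+* L) ((gramR L e dV hdV dW hdW).map (algebraMap (Fp L) L)),
      (S : Matrix (Fin 2) (Fin 2) L) ≠ 0 → (S : Matrix (Fin 2) (Fin 2) L).det = 0 →
        (S : Matrix (Fin 2) (Fin 2) L) = Matrix.vecMulVec (u S) (w S) ∧
        (∀ k : Fin 2, ((gramR L e dV hdV dW hdW).map (algebraMap (Fp L) L)) k k * (S : Matrix (Fin 2) (Fin 2) L) k k =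
          IsCMField.complexConj L (((γ (Projectivization.mk L (w S) (hw S)) : GL (Fin 2) L) : Matrix (Fin 2) (Fin 2) L) 1 k) *
            ((gramR L e dV hdV dW hdW).map (algebraMap (Fp L) L)) 1 1 * σc S * ((γ (Projectivization.mk L (w S) (hw S)) : GL (Fin 2) L) : Matrix (Fin 2) (Fin 2) L) 1 k) ∧
        gramR L e dV hdV dW hdW 1 1 * Algebra.trace (Fp L) L (σc S * imagUnit L) ≠ 0)
    (hTeq : ∀ S (h : HA L e dV hdV dW hdW), T S h = kindWFinset L e dV hdV dW hdW (T₀ ∪ Tp S) (Matrix.single 1 1 (σc S)) (gc S * h))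
    (hTp : ∀ S (v : HeightOneSpectrum (𝓞 (Fp L))), v ∈ Tp S ↔
      v ∈ Trec ∨ 1 < Valued.v (algebraMap (Fp L) (v.adicCompletion (Fp L)) (gramR L e dV hdV dW hdW 1 1 * Algebra.trace (Fp L) L (σc S * imagUnit L))))
    (hPm : ∀ S (h : HA L e dV hdV dW hdW), Pm S h = T S h \ T₀)
    -- the archimedean size
    (τa : skewMatrices ((IsCMField.complexConj L : L ≃ₐ[Fp L] L) : L →+* L) ((gramR L e dV hdV dW hdW).map (algebraMap (Fp L) L)) → ℝ)
    (hτa : ∀ S : skewMatrices ((IsCMField.complexConj L : L ≃ₐ[Fp L] L) : L →+* L) ((gramR L e dV hdV dW hdW).map (algebraMap (Fp L) L)),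
      ‖(fun i j => NumberField.mixedEmbedding L ((S : Matrix (Fin 2) (Fin 2) L) i j))‖ ≤ τa S) :
    ∃ (Np Nd : ℕ) (Cp ap : ℝ), 0 ≤ Cp ∧ 0 ≤ ap ∧
      ∀ (S : skewMatrices ((IsCMField.complexConj L : L ≃ₐ[Fp L] L) : L →+* L) ((gramR L e dV hdV dW hdW).map (algebraMap (Fp L) L))) (h : HA L e dV hdV dW hdW),
        (S : Matrix (Fin 2) (Fin 2) L) ≠ 0 → (S : Matrix (Fin 2) (Fin 2) L).det = 0 → ∀ D : ℕ, 1 ≤ D →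
        (∀ a b, IsIntegral ℤ ((D : L) * (S : Matrix (Fin 2) (Fin 2) L) a b)) →
          (16 / 3 : ℝ) ^ (Pm S h).card ≤
            Cp * adelicHeightGL (2 + 2) L (h : GL (Fin (2 + 2)) (AdeleRing (𝓞 L) L)) ^ ap * (1 + τa S) ^ Np * (D : ℝ) ^ Nd := by
  -- (C-d-i) ★ p864275: the corner-scalar denominator `d₀` and the pole count
  obtain ⟨d₀, hd₀, hden⟩ := exists_cornerScalar_den_pole_count L e dV hdV dW hdW hdV0 hdW0
  -- the three height bricks (B-i) ★ p863361, (B-ii) ★, (B-iii) ★, and the clause `‖Λ(γ[w'])‖ ≤ C₀ · H(w')^{k₀}` for the GIVEN normalised `γ` (as ★ (ρ6a))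
  obtain ⟨C₁, k₁, hC₁, hBi⟩ := exists_vecHeight_principalVec_le_mulHeight_pow (K := L) (ι := Fin 2)
  obtain ⟨C₂, hC₂, hBii⟩ := exists_adelicHeightGL_rowSection_le L
  obtain ⟨C₃, hC₃, hBiii⟩ := exists_adelicHeightGL_leviHom_le_sq L e dV hdV dW hdW hdV0 hdW0 Λ hΛ
  have hclause : ∀ (w' : Fin 2 → L) (hw' : w' ≠ 0),
      adelicHeightGL (2 + 2) L ((fun g : GL (Fin 2) (AdeleRing (𝓞 L) L) => ((Λ g : HA L e dV hdV dW hdW) : GL (Fin (2 + 2)) (AdeleRing (𝓞 L) L)))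
        (Matrix.GeneralLinearGroup.map (algebraMap L (AdeleRing (𝓞 L) L)) (γ (Projectivization.mk L w' hw')))) ≤
        (C₃ * (C₂ * C₁) ^ 2) * Height.mulHeight w' ^ (2 * k₁) := by
    intro w' hw'
    obtain ⟨i, hi, -, hent⟩ := hnorm w' hw'
    have h12 : adelicHeightGL 2 L (Matrix.GeneralLinearGroup.map (algebraMap L (AdeleRing (𝓞 L) L)) (γ (Projectivization.mk L w' hw'))) ≤
        C₂ * C₁ * Height.mulHeight w' ^ k₁ :=
      calc adelicHeightGL 2 L (Matrix.GeneralLinearGroup.map (algebraMap L (AdeleRing (𝓞 L) L)) (γ (Projectivization.mk L w' hw')))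
          ≤ C₂ * ((vecHeight L (principalVec L w') : ℝ≥0) : ℝ) := hBii w' i hi _ hent
        _ ≤ C₂ * (C₁ * Height.mulHeight w' ^ k₁) := mul_le_mul_of_nonneg_left (hBi w' hw') hC₂
        _ = C₂ * C₁ * Height.mulHeight w' ^ k₁ := by ring
    have h0 : 0 ≤ adelicHeightGL 2 L (Matrix.GeneralLinearGroup.map (algebraMap L (AdeleRing (𝓞 L) L)) (γ (Projectivization.mk L w' hw'))) :=
      adelicHeightGL_nonneg _
    calc adelicHeightGL (2 + 2) L ((Λ (Matrix.GeneralLinearGroup.map (algebraMap L (AdeleRing (𝓞 L) L)) (γ (Projectivization.mk L w' hw'))) :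
            HA L e dV hdV dW hdW) : GL (Fin (2 + 2)) (AdeleRing (𝓞 L) L))
        ≤ C₃ * adelicHeightGL 2 L (Matrix.GeneralLinearGroup.map (algebraMap L (AdeleRing (𝓞 L) L)) (γ (Projectivization.mk L w' hw'))) ^ 2 := hBiii _
      _ ≤ C₃ * (C₂ * C₁ * Height.mulHeight w' ^ k₁) ^ 2 := mul_le_mul_of_nonneg_left (pow_le_pow_left₀ h0 h12 2) hC₃
      _ = (C₃ * (C₂ * C₁) ^ 2) * Height.mulHeight w' ^ (2 * k₁) := by ring
  have hC₀ : 0 ≤ C₃ * (C₂ * C₁) ^ 2 := by positivity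
  -- the Weyl element's local heights (a constant of the datum)
  have hCΔ : 0 ≤ ∏ᶠ w', (GLn.localHeight (2 + 2) L w' ((weylDelta L e dV hdV dW hdW : HA L e dV hdV dW hdW) : GL (Fin (2 + 2)) (AdeleRing (𝓞 L) L)) : ℝ) :=
    finprod_nonneg fun _ => NNReal.coe_nonneg _
  -- THE CONSTANTS
  refine ⟨3 * (Module.finrank ℚ L * (2 * k₁)), 3 * (Module.finrank ℚ L * (2 * k₁)) + 3 * (2 * Module.finrank ℚ L) + 3 * Module.finrank ℚ (Fp L),
    (16 / 3 : ℝ) ^ Trec.card * (d₀ : ℝ) ^ (3 * Module.finrank ℚ (Fp L)) *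
      ((((2 + 2 : ℕ) : ℝ) * (((2 + 2 : ℕ) : ℝ) * (C₃ * (C₂ * C₁) ^ 2))) *
        (∏ᶠ w', (GLn.localHeight (2 + 2) L w' ((weylDelta L e dV hdV dW hdW : HA L e dV hdV dW hdW) : GL (Fin (2 + 2)) (AdeleRing (𝓞 L) L)) : ℝ)) *
        (d₀ : ℝ) ^ (2 * Module.finrank ℚ L)) ^ 3,
    3, by positivity, by norm_num, fun S h hS0 hdet D hD hDS => ?_⟩
  -- the objects of record for this `(S, h, D)`
  obtain ⟨hS1, hdiag, -⟩ := hpres S hS0 hdet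
  obtain ⟨i, hi, hrow, -⟩ := hnorm (w S) (hw S)
  have hD0 : D ≠ 0 := by omega
  have hDd0 : D * d₀ ≠ 0 := mul_ne_zero hD0 hd₀
  -- the pivot: `γ[w S]₁ᵢ = 1`, so `t_i · S_ii = t₁ · σc S`
  have h1i : ((γ (Projectivization.mk L (w S) (hw S)) : GL (Fin 2) L) : Matrix (Fin 2) (Fin 2) L) 1 i = 1 := by
    rw [hrow, Pi.smul_apply, smul_eq_mul, inv_mul_cancel₀ hi]
  have hpiv : ((gramR L e dV hdV dW hdW).map (algebraMap (Fp L) L)) i i * (S : Matrix (Fin 2) (Fin 2) L) i i =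
      ((gramR L e dV hdV dW hdW).map (algebraMap (Fp L) L)) 1 1 * σc S := by
    rw [hdiag i, h1i, map_one, one_mul, mul_one]
  obtain ⟨hσint, hpol⟩ := hden (σc S) ((S : Matrix (Fin 2) (Fin 2) L) i i) i D hD0 (hDS i i) hpiv
  -- (1) the KIND-W part off `T₀ ∪ Tp S`: ★ (C-c) at the corner index (denominator `D·d₀`; `(σc E₁₁)⁻¹ = 0`)
  have hCc := two_pow_card_kindWFinset_sdiff_le L e dV hdV dW hdW (T₀ ∪ Tp S) (Matrix.single 1 1 (σc S)) (gc S * h) hDd0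
    (fun a b => by
      rw [Matrix.single_apply]
      split_ifs
      · exact hσint
      · rw [mul_zero]; exact isIntegral_zero)
    (fun a b => by rw [inv_single_eq_zero, Matrix.zero_apply, mul_zero]; exact isIntegral_zero)
  -- (2) `∏_w H_w(gc S·h) ≤ 4‖gc S·h‖ ≤ 4·(4C₀)·(D(1+τa S))^k·‖h‖`
  have hS' : Matrix.vecMulVec (u S) (w S) ≠ 0 := hS1 ▸ hS0
  have hint' : ∀ a b, IsIntegral ℤ ((D : L) * Matrix.vecMulVec (u S) (w S) a b) := fun a b => by rw [← hS1]; exact hDS a b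
  have htr := adelicHeightGL_leviRow_translate_le L
    (fun g : GL (Fin 2) (AdeleRing (𝓞 L) L) => ((Λ g : HA L e dV hdV dW hdW) : GL (Fin (2 + 2)) (AdeleRing (𝓞 L) L))) γ hC₀ hclause
    (u S) (w S) (hw S) hS' hD hint' (h : GL (Fin (2 + 2)) (AdeleRing (𝓞 L) L))
  have hτ : ‖(fun a b => NumberField.mixedEmbedding L (Matrix.vecMulVec (u S) (w S) a b))‖ ≤ τa S := by rw [← hS1]; exact hτa S
  have hτ0 : 0 ≤ τa S := (norm_nonneg _).trans hτ
  have hh0 : 0 ≤ adelicHeightGL (2 + 2) L (h : GL (Fin (2 + 2)) (AdeleRing (𝓞 L) L)) := adelicHeightGL_nonneg _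
  have hgh : ((gc S * h : HA L e dV hdV dW hdW) : GL (Fin (2 + 2)) (AdeleRing (𝓞 L) L)) =
      ((Λ (Matrix.GeneralLinearGroup.map (algebraMap L (AdeleRing (𝓞 L) L)) (γ (Projectivization.mk L (w S) (hw S)))) : HA L e dV hdV dW hdW) :
        GL (Fin (2 + 2)) (AdeleRing (𝓞 L) L)) * (h : GL (Fin (2 + 2)) (AdeleRing (𝓞 L) L)) := by
    rw [hgc S]; rfl
  have hF : ∏ᶠ w', (GLn.localHeight (2 + 2) L w' ((gc S * h : HA L e dV hdV dW hdW) : GL (Fin (2 + 2)) (AdeleRing (𝓞 L) L)) : ℝ) ≤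
      ((2 + 2 : ℕ) : ℝ) * ((((2 + 2 : ℕ) : ℝ) * (C₃ * (C₂ * C₁) ^ 2)) * ((D : ℝ) * (1 + τa S)) ^ (Module.finrank ℚ L * (2 * k₁)) *
        adelicHeightGL (2 + 2) L (h : GL (Fin (2 + 2)) (AdeleRing (𝓞 L) L))) := by
    refine (finprod_localHeight_le_mul_adelicHeightGL _).trans (mul_le_mul_of_nonneg_left ?_ (Nat.cast_nonneg _))
    rw [hgh]
    have h1τ : (D : ℝ) * (1 + ‖(fun a b => NumberField.mixedEmbedding L (Matrix.vecMulVec (u S) (w S) a b))‖) ≤ (D : ℝ) * (1 + τa S) :=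
      mul_le_mul_of_nonneg_left (by linarith) (Nat.cast_nonneg D)
    exact htr.trans (mul_le_mul_of_nonneg_right (mul_le_mul_of_nonneg_left (pow_le_pow_left₀ (by positivity) h1τ _) (by positivity)) hh0)
  -- (3) the pole count and the record set
  have hP : (16 / 3 : ℝ) ^ ((Tp S).filter (fun v => 1 < Valued.v (algebraMap (Fp L) (v.adicCompletion (Fp L))
      (gramR L e dV hdV dW hdW 1 1 * Algebra.trace (Fp L) L (σc S * imagUnit L))))).card ≤ ((D * d₀ : ℕ) : ℝ) ^ (3 * Module.finrank ℚ (Fp L)) :=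
    hpol _ (fun v hv => (Finset.mem_filter.1 hv).2)
  -- the cardinality split `#Pm ≤ #(K ∖ (T₀ ∪ Tp S)) + #T_rec + #Pol`
  have hcard : (Pm S h).card ≤ (kindWFinset L e dV hdV dW hdW (T₀ ∪ Tp S) (Matrix.single 1 1 (σc S)) (gc S * h) \ (T₀ ∪ Tp S)).card + Trec.card +
      ((Tp S).filter (fun v => 1 < Valued.v (algebraMap (Fp L) (v.adicCompletion (Fp L))
        (gramR L e dV hdV dW hdW 1 1 * Algebra.trace (Fp L) L (σc S * imagUnit L))))).card := by
    rw [hPm, hTeq]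
    refine (Finset.card_le_card ?_).trans ((Finset.card_union_le _ _).trans (add_le_add_left (Finset.card_union_le _ _) _))
    intro v hv
    rw [Finset.mem_sdiff] at hv
    rw [Finset.mem_union, Finset.mem_union, Finset.mem_sdiff, Finset.mem_union, Finset.mem_filter]
    by_cases hvT : v ∈ Tp S
    · rcases (hTp S v).1 hvT with h' | h'
      · exact Or.inl (Or.inr h')
      · exact Or.inr ⟨hvT, h'⟩
    · exact Or.inl (Or.inl ⟨hv.1, not_or.2 ⟨hv.2, hvT⟩⟩)
  -- ASSEMBLY
  have h163 : (1 : ℝ) ≤ 16 / 3 := by norm_num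
  have hA : (16 / 3 : ℝ) ^ (kindWFinset L e dV hdV dW hdW (T₀ ∪ Tp S) (Matrix.single 1 1 (σc S)) (gc S * h) \ (T₀ ∪ Tp S)).card ≤
      ((((2 + 2 : ℕ) : ℝ) * ((((2 + 2 : ℕ) : ℝ) * (C₃ * (C₂ * C₁) ^ 2)) * ((D : ℝ) * (1 + τa S)) ^ (Module.finrank ℚ L * (2 * k₁)) *
        adelicHeightGL (2 + 2) L (h : GL (Fin (2 + 2)) (AdeleRing (𝓞 L) L)))) *
        (∏ᶠ w', (GLn.localHeight (2 + 2) L w' ((weylDelta L e dV hdV dW hdW : HA L e dV hdV dW hdW) : GL (Fin (2 + 2)) (AdeleRing (𝓞 L) L)) : ℝ)) *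
        ((D * d₀ : ℕ) : ℝ) ^ (2 * Module.finrank ℚ L)) ^ 3 :=
    calc (16 / 3 : ℝ) ^ (kindWFinset L e dV hdV dW hdW (T₀ ∪ Tp S) (Matrix.single 1 1 (σc S)) (gc S * h) \ (T₀ ∪ Tp S)).card
        ≤ ((2 : ℝ) ^ 3) ^ (kindWFinset L e dV hdV dW hdW (T₀ ∪ Tp S) (Matrix.single 1 1 (σc S)) (gc S * h) \ (T₀ ∪ Tp S)).card :=
          pow_le_pow_left₀ (by norm_num) (by norm_num) _
      _ = ((2 : ℝ) ^ (kindWFinset L e dV hdV dW hdW (T₀ ∪ Tp S) (Matrix.single 1 1 (σc S)) (gc S * h) \ (T₀ ∪ Tp S)).card) ^ 3 := by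
          rw [← pow_mul, ← pow_mul, mul_comm]
      _ ≤ _ := pow_le_pow_left₀ (by positivity) (hCc.trans (mul_le_mul_of_nonneg_right (mul_le_mul_of_nonneg_right hF hCΔ) (by positivity))) 3
  calc (16 / 3 : ℝ) ^ (Pm S h).card
      ≤ (16 / 3 : ℝ) ^ ((kindWFinset L e dV hdV dW hdW (T₀ ∪ Tp S) (Matrix.single 1 1 (σc S)) (gc S * h) \ (T₀ ∪ Tp S)).card + Trec.card +
          ((Tp S).filter (fun v => 1 < Valued.v (algebraMap (Fp L) (v.adicCompletion (Fp L))
            (gramR L e dV hdV dW hdW 1 1 * Algebra.trace (Fp L) L (σc S * imagUnit L))))).card) := pow_le_pow_right₀ h163 hcard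
    _ = (16 / 3 : ℝ) ^ (kindWFinset L e dV hdV dW hdW (T₀ ∪ Tp S) (Matrix.single 1 1 (σc S)) (gc S * h) \ (T₀ ∪ Tp S)).card * (16 / 3 : ℝ) ^ Trec.card *
          (16 / 3 : ℝ) ^ ((Tp S).filter (fun v => 1 < Valued.v (algebraMap (Fp L) (v.adicCompletion (Fp L))
            (gramR L e dV hdV dW hdW 1 1 * Algebra.trace (Fp L) L (σc S * imagUnit L))))).card := by rw [pow_add, pow_add]
    _ ≤ ((((2 + 2 : ℕ) : ℝ) * ((((2 + 2 : ℕ) : ℝ) * (C₃ * (C₂ * C₁) ^ 2)) * ((D : ℝ) * (1 + τa S)) ^ (Module.finrank ℚ L * (2 * k₁)) *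
          adelicHeightGL (2 + 2) L (h : GL (Fin (2 + 2)) (AdeleRing (𝓞 L) L)))) *
          (∏ᶠ w', (GLn.localHeight (2 + 2) L w' ((weylDelta L e dV hdV dW hdW : HA L e dV hdV dW hdW) : GL (Fin (2 + 2)) (AdeleRing (𝓞 L) L)) : ℝ)) *
          ((D * d₀ : ℕ) : ℝ) ^ (2 * Module.finrank ℚ L)) ^ 3 * (16 / 3 : ℝ) ^ Trec.card * ((D * d₀ : ℕ) : ℝ) ^ (3 * Module.finrank ℚ (Fp L)) :=
        mul_le_mul (mul_le_mul_of_nonneg_right hA (by positivity)) hP (by positivity) (by positivity)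
    _ = (16 / 3 : ℝ) ^ Trec.card * (d₀ : ℝ) ^ (3 * Module.finrank ℚ (Fp L)) *
          ((((2 + 2 : ℕ) : ℝ) * (((2 + 2 : ℕ) : ℝ) * (C₃ * (C₂ * C₁) ^ 2))) *
            (∏ᶠ w', (GLn.localHeight (2 + 2) L w' ((weylDelta L e dV hdV dW hdW : HA L e dV hdV dW hdW) : GL (Fin (2 + 2)) (AdeleRing (𝓞 L) L)) : ℝ)) *
            (d₀ : ℝ) ^ (2 * Module.finrank ℚ L)) ^ 3 *
          adelicHeightGL (2 + 2) L (h : GL (Fin (2 + 2)) (AdeleRing (𝓞 L) L)) ^ (3 : ℝ) * (1 + τa S) ^ (3 * (Module.finrank ℚ L * (2 * k₁))) *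
          (D : ℝ) ^ (3 * (Module.finrank ℚ L * (2 * k₁)) + 3 * (2 * Module.finrank ℚ L) + 3 * Module.finrank ℚ (Fp L)) := by
        rw [show (3 : ℝ) = ((3 : ℕ) : ℝ) by norm_num, Real.rpow_natCast]
        push_cast
        simp only [mul_pow]
        ring

end Count

end Summit.HodgeConjecture.HodgeConjecture.Cruxes.HLiu418.K2LiuKindOneSingularShellCount

end
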